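import Literature.NumberTheory.ComplexMultiplication.ReflexNormArtinMapCyclotomic
import Literature.NumberTheory.ComplexMultiplication.HeckeCharactersOfReflexNormSection
import Literature.NumberTheory.NumberFields.IdelicArtinMapRatKernel
import Literature.NumberTheory.NumberFields.IdelicArtinMapOpenSubgroups
import HarnessLib

/-!
# Milne, *Complex Multiplication*, Ch. II §9, LEMMA 9.7 AS PRINTED, with the sign:
# `N_Φ(s) · ι_E N_Φ(s) ∈ χ_cyc(art_{E*}(s)) · ℚ_{>0}`; and the `η` of LEMMA 9.8 is continuous

Layer `Literature/NumberTheory/ComplexMultiplication`; namespace `Literature.NumberTheory.ComplexMultiplication`.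
Lane `lit-hodgefound` (Track 2, Layer A3 skeleton seat `skel-3`, row A3-G41 FILE 2: rider to row A3-G40's
`…ComplexMultiplication/ReflexNormArtinMapCyclotomic`, which proved the lemma with `ℚ^×` in place of `ℚ_{>0}` and
recorded the sign as a deviation, and to row A3-G39's `…/ReflexNormArtinMap` (`reflexNormArtinHom`).  THEOREMS ONLY, all proved: no definition, no named fact, no `sorry` (D-0026, net
debt 0).

## The print

J. S. Milne, *Complex Multiplication* (course notes, version of July 14, 2020; open text `paper:url-8ccc30e4daab`,
p0077 L8–L12) [MilneCM2006], Ch. II §9 (= J. S. Milne, *The fundamental theorem of complex multiplication*,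
arXiv:0705.3446 (2007), Lemma 3.7, held text `paper:arxiv-0705.3446` p0015 L132–L140 [Milne2007FundamentalCM]):

> «LEMMA 9.7 Let `E` be a CM-field and let `Φ` be a CM-type on `E`. For any `s ∈ 𝔸^×_{f,E*}`,
> `N_Φ(s) · ι_E N_Φ(s) ∈ χ_cyc(art_{E*}(s)) · ℚ_{>0}`.
> PROOF. According to (10), `N_Φ(s) · ι_E N_Φ(s) = Nm_{E*/ℚ}(s)`, and so we can apply (9.5).»

The positivity is what the proof of LEMMA 9.14 (p. 79) consumes: «`N_Φ(s) · ιN_Φ(s) = Nm(s) = χ_cyc(σ) · a` for some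
`a ∈ ℚ_{>0}` […] Being a totally positive element of `F`, `ac` is a local norm from `E` at the infinite primes».

## Setting and conventions (as in `…/ReflexNormArtinMapCyclotomic`)

`E = K : Type` a CM number field with `ι_E` on finite idèles `finiteIdeleComplexConj K`, `Φ : CMType K`,
`E* = traceField Φ ⊂ ℂ`, `k : IntermediateField ℚ ℂ` a number field with `hk : traceField Φ ≤ k` (printed case
`k = E*`; `N_{k,Φ} = reflexNormIdele K Φ k = N_Φ ∘ Nm_{k/E*}`); `con_f = FiniteAdeleRing.mapSemialgHom (𝓞 ℚ) ℚ K (𝓞 K)`,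
`x_𝐡 = IdeleAction.finitePart`.  The tree's `[·, k] = ideleArtinMap k = rec_k = art_k⁻¹`, so Milne's `σ` with
«`σ|E^ab = art_{E*}(s)`» is `τ⁻¹` for any `τ ∈ Γ_k` lifting `[s, k]`, and «`∈ χ_cyc(σ) · ℚ_{>0}`» reads
«`= (q) · con_f(χ_cyc(res_{k/ℚ} τ⁻¹))` with `q ∈ ℚ_{>0}`».  A field `k ⊇ E*` is totally complex (`E*` is a CM field;
the tree's `isTotallyComplex_of_traceField_le` of `…/HeckeCharactersOfReflexNormSection`), so `[s, k]` depends only on `s_𝐡` — the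
printed «`art_k` factors through `𝔸^×_{f,k}`» — and row A3-G41 FILE 1's LEMMA 9.5 with the sign
(`exists_pos_finitePart_ideleRelNorm_eq`) applies to EVERY `s ∈ 𝕀_k`.

## What is proved

* **`exists_pos_finitePart_reflexNormIdele_mul_conj_eq_mul_cyclotomic`** (LEMMA 9.7 AS PRINTED): if `τ ∈ Γ_k` lifts
  `[s, k]` then `N_{k,Φ}(s)_𝐡 · ι_E N_{k,Φ}(s)_𝐡 = (q)_E · con_f(χ_cyc(res_{k/ℚ} τ⁻¹))` in `𝔸_{E,f}` for some
  `q ∈ ℚ_{>0}` — by (10) on finite parts (`finitePart_reflexNormIdele_mul_conj`, row A3-G39 FILE 3) and LEMMA 9.5 with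
  the sign (row A3-G41 FILE 1).
* `exists_pos_finitePart_reflexNormIdele_mul_conj_mul_con_cyclotomicIdele_eq` — the same as
  `N_{k,Φ}(s)_𝐡 · ι_E N_{k,Φ}(s)_𝐡 · con(1, χ_cyc(res τ))_𝐡 = (q)_E`, `q ∈ ℚ_{>0}` (the element of `E^×` produced by
  A3-G40's `finitePart_reflexNormIdele_mul_conj_mul_con_cyclotomicIdele_mem_range` is a POSITIVE RATIONAL).
* **`continuous_reflexNormArtinHom`** — the homomorphism `η_Φ : Gal(k^ab/k) → Gal(E^ab/E)` of LEMMA 9.8 (row A3-G39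
  FILE 3's `reflexNormArtinHom`, `η_Φ [s, k] = [N_{k,Φ}(s), E]`) is CONTINUOUS (row A3-G41 FILE 3's
  `continuous_inducedArtinHom`; continuity is not asserted in the print, which says «unique homomorphism»).

## References

* J. S. Milne, *Complex Multiplication* (2006; version July 14, 2020), Ch. II §9, Lemma 9.7 (p. 77) and the proof of
  Lemma 9.14 (p. 79). [MilneCM2006]
* J. S. Milne, *The fundamental theorem of complex multiplication*, arXiv:0705.3446 (2007), Lemma 3.7. [Milne2007FundamentalCM]
* G. Shimura, *Abelian Varieties with Complex Multiplication and Modular Functions* (1998), §18.5 (18.5c). [Shimura1998]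

## Provenance

Lane `lit-hodgefound`, seat `literature-prover-lit-hodgefound-skel-3-g27-0` (row A3-G41, FILE 2 = rider).
-/

set_option autoImplicit false

noncomputable section

open scoped TensorProduct NumberField

namespace Literature.NumberTheory.ComplexMultiplication

open Literature.AlgebraicGeometry.GaoUllmo2025
open Literature.AlgebraicGeometry.Motives (CMType)
open Literature.NumberTheory.AdelicBaseChange
open Literature.NumberTheory.GaloisRepresentations (ideleGroup absGaloisAbProj absGaloisRestrict)
open Literature.NumberTheory.NumberFields
open NumberField IsDedekindDomain Field

section NinePointSevenSign

variable (K : Type) [Field K] [NumberField K] [IsCMField K] (Φ : CMType K)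
  (k : IntermediateField ℚ ℂ) [NumberField k]

/-- **MILNE CM LEMMA 9.7 AS PRINTED, WITH THE SIGN `ℚ_{>0}`**: if `τ ∈ Γ_k` lifts `[s, k]` (`k ⊇ E*`, any `s ∈ 𝕀_k`),
then `N_{k,Φ}(s)_𝐡 · ι_E N_{k,Φ}(s)_𝐡 = (q)_E · con_f(χ_cyc(res_{k/ℚ} τ⁻¹))` in `𝔸_{E,f}` for some POSITIVE rational `q`
— «`N_Φ(s) · ι_E N_Φ(s) ∈ χ_cyc(art_{E*}(s)) · ℚ_{>0}`» with Milne's `σ = τ⁻¹` (`art = rec⁻¹`).  PROOF (Milne's):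
«According to (10), `N_Φ(s) · ι_E N_Φ(s) = Nm_{E*/ℚ}(s)`, and so we can apply (9.5)»:
`finitePart_reflexNormIdele_mul_conj` ((10) on finite parts) and LEMMA 9.5 with the sign for the totally complex `k`
(`exists_pos_finitePart_ideleRelNorm_eq`), transported by the conorm. [cite: MilneCM2006, Ch. II §9, Lemma 9.7 (p. 77)]
[cite: Milne2007FundamentalCM, Lemma 3.7] [cite: Shimura1998, §18.5 (18.5c)] -/
theorem exists_pos_finitePart_reflexNormIdele_mul_conj_eq_mul_cyclotomic (hk : traceField Φ ≤ k)
    {s : ideleGroup k} {τ : absoluteGaloisGroup k} (hτ : absGaloisAbProj k τ = ideleArtinMap k s) :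
    ∃ q : ℚˣ, 0 < (q : ℚ) ∧
      ((IdeleAction.finitePart K (reflexNormIdele K Φ k s) *
            finiteIdeleComplexConj K (IdeleAction.finitePart K (reflexNormIdele K Φ k s)) :
            (FiniteAdeleRing (𝓞 K) K)ˣ) : FiniteAdeleRing (𝓞 K) K) =
        algebraMap K (FiniteAdeleRing (𝓞 K) K) (algebraMap ℚ K (q : ℚ)) *
          FiniteAdeleRing.mapSemialgHom (𝓞 ℚ) ℚ K (𝓞 K)
            ((cyclotomicFiniteIdele (absGaloisRestrict ℚ k τ⁻¹) : (FiniteAdeleRing (𝓞 ℚ) ℚ)ˣ) :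
              FiniteAdeleRing (𝓞 ℚ) ℚ) := by
  haveI : IsTotallyComplex k := isTotallyComplex_of_traceField_le K Φ k hk
  obtain ⟨q, hqpos, hq⟩ := exists_pos_finitePart_ideleRelNorm_eq s hτ
  refine ⟨q, hqpos, ?_⟩
  have hq' : ((ideleRelNorm ℚ k s : ideleGroup ℚ) : AdeleRing (𝓞 ℚ) ℚ).2 =
      algebraMap ℚ (FiniteAdeleRing (𝓞 ℚ) ℚ) (q : ℚ) *
        ((cyclotomicFiniteIdele (absGaloisRestrict ℚ k τ⁻¹) : (FiniteAdeleRing (𝓞 ℚ) ℚ)ˣ) :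
          FiniteAdeleRing (𝓞 ℚ) ℚ) := by
    rw [← IdeleAction.coe_finitePart, hq, Units.val_mul, FiniteAdeleRing.unitEmbedding_apply]
  rw [finitePart_reflexNormIdele_mul_conj K Φ k hk s, IdeleAction.coe_finitePart, Units.coe_map, MonoidHom.coe_coe,
    NumberField.AdeleRing.baseChange_snd_apply, hq', map_mul]
  congr 1
  exact ContinuousSemialgHom.commutes _ _ _ (FiniteAdeleRing.mapSemialgHom (𝓞 ℚ) ℚ K (𝓞 K)) (q : ℚ)

/-- **LEMMA 9.7 with the sign, product form**: `N_{k,Φ}(s)_𝐡 · ι_E N_{k,Φ}(s)_𝐡 · con(1, χ_cyc(res_{k/ℚ} τ))_𝐡 = (q)_E`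
with `q ∈ ℚ_{>0}` — the element of `E^×` of row A3-G40's `finitePart_reflexNormIdele_mul_conj_mul_con_cyclotomicIdele_mem_range`
is the principal finite idèle of a POSITIVE RATIONAL. [cite: MilneCM2006, Ch. II §9, Lemma 9.7 (p. 77)]
[cite: Milne2007FundamentalCM, Lemma 3.7] -/
theorem exists_pos_finitePart_reflexNormIdele_mul_conj_mul_con_cyclotomicIdele_eq (hk : traceField Φ ≤ k)
    {s : ideleGroup k} {τ : absoluteGaloisGroup k} (hτ : absGaloisAbProj k τ = ideleArtinMap k s) :
    ∃ q : ℚˣ, 0 < (q : ℚ) ∧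
      IdeleAction.finitePart K (reflexNormIdele K Φ k s) *
            finiteIdeleComplexConj K (IdeleAction.finitePart K (reflexNormIdele K Φ k s)) *
          IdeleAction.finitePart K
            (Units.map (NumberField.AdeleRing.baseChange ℚ K : AdeleRing (𝓞 ℚ) ℚ →* AdeleRing (𝓞 K) K)
              (cyclotomicIdele (absGaloisRestrict ℚ k τ))) =
        FiniteAdeleRing.unitEmbedding (𝓞 K) K (Units.map (algebraMap ℚ K : ℚ →* K) q) := by
  haveI : IsTotallyComplex k := isTotallyComplex_of_traceField_le K Φ k hk
  obtain ⟨q, hqpos, hq⟩ := exists_pos_finitePart_ideleRelNorm_mul_cyclotomicIdele_eq s hτ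
  refine ⟨q, hqpos, ?_⟩
  rw [finitePart_reflexNormIdele_mul_conj K Φ k hk s, ← map_mul, ← map_mul]
  -- `con(Nm s · (1, χ))_𝐡 = con_f((Nm s · (1,χ))_𝐡) = con_f((q)) = (q)_E`
  apply Units.ext
  rw [IdeleAction.coe_finitePart, Units.coe_map, MonoidHom.coe_coe, NumberField.AdeleRing.baseChange_snd_apply,
    ← IdeleAction.coe_finitePart, hq, FiniteAdeleRing.unitEmbedding_apply, FiniteAdeleRing.unitEmbedding_apply,
    Units.coe_map, MonoidHom.coe_coe]
  exact ContinuousSemialgHom.commutes _ _ _ (FiniteAdeleRing.mapSemialgHom (𝓞 ℚ) ℚ K (𝓞 K)) (q : ℚ)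

end NinePointSevenSign

section NinePointEightContinuity

variable (K : Type) [Field K] [NumberField K] (Φ : CMType K) (k : IntermediateField ℚ ℂ) [NumberField k]

/-- **The `η_Φ` of MILNE CM LEMMA 9.8 is continuous**: `reflexNormArtinHom K Φ k : Gal(k^ab/k) →* Gal(E^ab/E)`, the
unique homomorphism with `η_Φ ∘ [·, k] = [·, E] ∘ N_{k,Φ}`, is continuous — because `[·, E] ∘ N_{k,Φ}` is
(`continuous_reflexNormIdele`, `continuous_ideleArtinMap`) and a homomorphism out of `Gal(k^ab/k)` with continuous
pull-back to `𝕀_k` is continuous (`continuous_inducedArtinHom`, Tate VII §5.1 (D) + §5.4).  The print asserts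
existence and uniqueness; continuity is the tree's addition. [cite: MilneCM2006, Ch. II §9, Lemma 9.8 (p. 77)]
[cite: CasselsFrohlichANT1967, Ch. VII §5.4 (PDF p. 213)] -/
theorem continuous_reflexNormArtinHom : Continuous (reflexNormArtinHom K Φ k) :=
  continuous_inducedArtinHom _ _ _

end NinePointEightContinuity

end Literature.NumberTheory.ComplexMultiplication

end
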